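import Mathlib

/-!
# T5FrobeniusRep — [A-2] through Mathlib's Frobenius reciprocity, in the category `Rep k G`

Tier-5 support for sub-step N3, row T2 / Lemma (D_σ)-cusp (route/T5-SUPPORT-p3.md §14(e), the
inference [A-2]: «cuspidal ⇒ not a (sub-)quotient of a properly induced representation (Q-8 + Q-9 +
Frobenius reciprocity)»).  File 28 (T5FrobeniusVanishing, p392671) proved the direction used on
Mathlib's `Representation.coind` by hand (evaluation at `1`).  This file derives the same statement
from Mathlib's NAMED Frobenius reciprocity `Rep.resCoindHomEquiv : (res φ B ⟶ A) ≃ₗ[k] (B ⟶ coind φ A)`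
(the adjunction `res φ ⊣ coind φ`), so that «Frobenius reciprocity itself» (§15(c)(ii)) is no longer
a prose step in the abstract (full function-space) setting:

* `hom_res_eq_zero_of_coinvariants` : an `S`-map `res S.subtype B ⟶ A` into an `N`-trivial `A`
  vanishes when `B_N = 0` (`Coinvariants.ker (B.ρ ∘ N.subtype) = ⊤`), `N ≤ S`;
* `hom_coind_eq_zero_of_coinvariants` : hence every `G`-map `B ⟶ coind S.subtype A` is `0` —
  Frobenius reciprocity transports the vanishing;
* `not_mono_coind_of_coinvariants` : no non-zero `B` embeds in `coind S.subtype A`.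

Dictionary: `G = U(W_v)`, `S = P′` the line stabiliser (Borel), `N = [B, B]` its unipotent radical
(files 25/26/29), `A` = the Levi representation inflated to `P′` (trivial on `N`), `B = π` cuspidal
(`π_N = 0`, Q-8).  What stays prose: smooth vs full function-space induction, the modulus twist,
Q-9.  Everything is proved (0 sorries); axioms ⊆ {propext, Classical.choice, Quot.sound}.
KEY-HYGIENE (README §8(d)): uses an L-value-free non-vanishing device: NO.
-/

universe u v

namespace Summit.Ventures.HodgeRepro2.T5FrobeniusRep

open CategoryTheory Representation

variable {k : Type u} [CommRing k] {G : Type v} [Group G]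

/-- The `N`-coinvariant kernel of `B` is contained in the kernel of every `k`-linear map that is
constant on `N`-orbits. -/
theorem coinvariantsKer_le_ker {V W : Type*} [AddCommGroup V] [Module k V] [AddCommGroup W]
    [Module k W] (ρ : Representation k G V) (N : Subgroup G) (f : V →ₗ[k] W)
    (hf : ∀ n ∈ N, ∀ v, f (ρ n v) = f v) :
    Coinvariants.ker (ρ.comp N.subtype) ≤ LinearMap.ker f := by
  unfold Coinvariants.ker
  rw [Submodule.span_le]
  rintro _ ⟨⟨n, v⟩, rfl⟩
  simp only [SetLike.mem_coe, LinearMap.mem_ker, map_sub, MonoidHom.comp_apply,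
    Subgroup.subtype_apply]
  rw [hf n n.2 v, sub_self]

/-- An `S`-equivariant map `res S.subtype B ⟶ A` into an `N`-trivial `A` (`N ≤ S`) vanishes
when `B` has no non-zero `N`-coinvariants. -/
theorem hom_res_eq_zero_of_coinvariants (S N : Subgroup G) (hN : N ≤ S)
    (A : Rep.{v} k S) (hA : ∀ n : S, (n : G) ∈ N → A.ρ n = LinearMap.id)
    (B : Rep.{v} k G) (hB : Coinvariants.ker (B.ρ.comp N.subtype) = ⊤)
    (g : Rep.res S.subtype B ⟶ A) : g = 0 := by
  have hle : Coinvariants.ker (B.ρ.comp N.subtype) ≤ LinearMap.ker g.hom.toLinearMap := by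
    apply coinvariantsKer_le_ker
    intro n hn v
    have := Rep.hom_comm_apply g ⟨n, hN hn⟩ v
    simp only [Rep.res_obj_ρ, MonoidHom.comp_apply, Subgroup.subtype_apply] at this
    rw [IntertwiningMap.toLinearMap_apply, this, hA ⟨n, hN hn⟩ hn]
    rfl
  rw [hB, top_le_iff] at hle
  apply Rep.hom_ext
  apply IntertwiningMap.ext
  apply LinearMap.ext
  intro v
  have hv : v ∈ LinearMap.ker g.hom.toLinearMap := by rw [hle]; trivial
  exact hv

/-- **[A-2] via Frobenius reciprocity**: if `B_N = 0` and `A` is `N`-trivial (`N ≤ S`), every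
`G`-map `B ⟶ coind S.subtype A` is zero. -/
theorem hom_coind_eq_zero_of_coinvariants (S N : Subgroup G) (hN : N ≤ S)
    (A : Rep.{v} k S) (hA : ∀ n : S, (n : G) ∈ N → A.ρ n = LinearMap.id)
    (B : Rep.{v} k G) (hB : Coinvariants.ker (B.ρ.comp N.subtype) = ⊤)
    (f : B ⟶ Rep.coind S.subtype A) : f = 0 := by
  have h := hom_res_eq_zero_of_coinvariants S N hN A hA B hB
    ((Rep.resCoindHomEquiv S.subtype B A).symm f)
  have := congrArg (Rep.resCoindHomEquiv S.subtype B A) h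
  rwa [LinearEquiv.apply_symm_apply, map_zero] at this

/-- No non-zero `B` with `B_N = 0` embeds into `coind S.subtype A` for `N`-trivial `A`. -/
theorem not_mono_coind_of_coinvariants (S N : Subgroup G) (hN : N ≤ S)
    (A : Rep.{v} k S) (hA : ∀ n : S, (n : G) ∈ N → A.ρ n = LinearMap.id)
    (B : Rep.{v} k G) (hB : Coinvariants.ker (B.ρ.comp N.subtype) = ⊤) [Nontrivial B]
    (f : B ⟶ Rep.coind S.subtype A) : ¬ Function.Injective f.hom := by
  intro hf
  rw [hom_coind_eq_zero_of_coinvariants S N hN A hA B hB f] at hf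
  obtain ⟨x, y, hxy⟩ := exists_pair_ne B
  exact hxy (hf (by simp))

end Summit.Ventures.HodgeRepro2.T5FrobeniusRep
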